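import Literature.Geometry.Kaehler.RiemannSurfaceUnramifiedAbelianExtensions
import Literature.Geometry.Kaehler.RiemannSurfaceGenusOneFundamentalGroup
import HarnessLib

/-!
# Unramified holomorphic coverings of compact Riemann surfaces of genus `0` and `1`

Topic `Literature/Geometry/Kaehler` — the two abelian cases of the lane's π₁ ∕ function-field dictionary for
unramified holomorphic coverings `q : Y → N` of compact connected Riemann surfaces
(`RiemannSurfaceUnramifiedCoveringFunctionField`, `RiemannSurfaceUnramifiedAbelianExtensions`), using
`RiemannSurfaceFiniteFundamentalGroup` (`g = 0 ⇔` simply connected, Farkas–Kra IV.6.1 (a)) and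
`RiemannSurfaceGenusOneFundamentalGroup` (`g = 1 ⇒ π₁ ≅ ℤ²` abelian, IV.6.1 (b)).

## What is proved (everything; no definitions, no instances, no named facts)

For an unramified holomorphic covering `q : Y → N` of compact connected Riemann surfaces, `K = q^*𝒦(N)`:
* §1 (`g(N) = 0`) **`bijective_of_arithGenus_eq_zero`** — `q` is bijective, indeed a biholomorphism
  (`exists_homeomorph_of_arithGenus_eq_zero`), `g(Y) = 0`, and `𝒦(Y) = K` (`finrank_eq_one_of_arithGenus_eq_zero`):
  the Riemann sphere has no non-trivial unramified coverings (it is simply connected);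
* §2 (`g(N) = 1`) **`normal_range_mapOfEq_of_arithGenus_eq_one`** (every unramified covering of a torus is
  normal = Galois, `π₁` being abelian), `arithGenus_eq_one_of_arithGenus_eq_one` (`g(Y) = 1`),
  **`isGalois_and_comm_of_arithGenus_eq_one`** (`𝒦(Y)/K` is an ABELIAN Galois extension),
  `natCard_algEquiv_eq_ncard_of_arithGenus_eq_one` (`|Gal| =` number of sheets `= [𝒦(Y) : K]`),
  **`exists_surjective_pi_int_two_gal_of_arithGenus_eq_one`** (`Gal` is a quotient of `ℤ²`: two generators), and
  conversely **`exists_genus_one_cover_of_addMonoidHom_surjective`** (every finite abelian group on two generators is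
  the Galois group of `𝒦(T)/p^*𝒦(N)` for an unramified holomorphic covering `p : T → N` by a torus `T`, `g(T) = 1`).

## References
* H. M. Farkas, I. Kra, *Riemann Surfaces*, 2nd ed., GTM 71, Springer 1992, IV.6.1, IV.6.3–6.4, I.2.7, V.1.10. [FarkasKra1992]
* O. Forster, *Lectures on Riemann Surfaces*, GTM 81, Springer 1981, §8.12 Theorem, §8.3. [Forster1981]
* A. Hatcher, *Algebraic Topology*, CUP 2002, §1.3 Prop. 1.39 (p. 71), Example 1.13. [HatcherAT2002]
-/

noncomputable section

open scoped Manifold ContDiff Topology IntermediateField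
open Set Function MulAction Module

namespace Literature.Geometry.Kaehler

open Literature.Topology.CoveringSpaces

namespace RiemannSurface

open FunctionField

universe u v

variable {N : Type u} [TopologicalSpace N] [ChartedSpace ℂ N] [ConnectedSpace N] [IsManifold 𝓘(ℂ, ℂ) ω N]
  [CompactSpace N] [T2Space N]
  {Y : Type v} [TopologicalSpace Y] [ChartedSpace ℂ Y] [ConnectedSpace Y] [IsManifold 𝓘(ℂ, ℂ) ω Y]
  [CompactSpace Y] [T2Space Y]
  {q : Y → N} (hq : MDifferentiable 𝓘(ℂ, ℂ) 𝓘(ℂ, ℂ) q) (hne : ∃ a b, q a ≠ q b) (hc : IsCoveringMap q)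

/-! ### §1 Genus `0`: no non-trivial unramified coverings -/

include hc in
omit [IsManifold 𝓘(ℂ, ℂ) ω Y] [CompactSpace Y] [T2Space Y] in
/-- **An unramified holomorphic covering of a compact Riemann surface of genus `0` has one sheet**: `N` is simply
connected (IV.6.1 (a)), so `q_* π₁(Y) = π₁(N) = 1` has index `1`. [cite: FarkasKra1992, IV.6.1 Theorem (a), IV.6.3]
[cite: HatcherAT2002, §1.3 Prop. 1.32 (p. 61)] -/
theorem ncard_preimage_eq_one_of_arithGenus_eq_zero (h0 : arithGenus N = 0) (y : N) : (q ⁻¹' {y}).ncard = 1 := by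
  haveI := simplyConnectedSpace_iff_arithGenus_eq_zero.2 h0
  obtain ⟨e₀⟩ : Nonempty Y := inferInstance
  rw [ncard_preimage_eq_index_range_mapOfEq hc (⟨e₀, rfl⟩ : q ⁻¹' {q e₀}) y]
  have htop : (FundamentalGroup.mapOfEq ⟨q, hc.continuous⟩ (⟨e₀, rfl⟩ : q ⁻¹' {q e₀}).2).range = ⊤ :=
    eq_top_iff.2 fun γ _ ↦ by rw [Subsingleton.elim γ 1]; exact one_mem _
  rw [htop, Subgroup.index_top]

include hc in
omit [IsManifold 𝓘(ℂ, ℂ) ω Y] [T2Space Y] in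
/-- **The Riemann sphere (genus `0`) has no non-trivial unramified coverings**: an unramified holomorphic covering map
onto a compact Riemann surface of genus `0` from a compact connected one is bijective.
[cite: FarkasKra1992, IV.6.1 Theorem (a), IV.6.3] -/
theorem bijective_of_arithGenus_eq_zero (h0 : arithGenus N = 0) : Bijective q := by
  refine ⟨fun a b hab ↦ ?_, hc.surjective_of_finite hc.finite_preimage_singleton_of_compactSpace⟩
  have h1 := ncard_preimage_eq_one_of_arithGenus_eq_zero hc h0 (q a)
  rw [Set.ncard_eq_one] at h1
  obtain ⟨c, hc1⟩ := h1
  have ha : a ∈ q ⁻¹' {q a} := rfl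
  have hb : b ∈ q ⁻¹' {q a} := hab.symm
  rw [hc1, mem_singleton_iff] at ha hb
  rw [ha, hb]

include hq hc in
omit [T2Space Y] in
/-- The biholomorphic form: an unramified holomorphic covering of a genus-`0` compact Riemann surface is a
biholomorphism (`q⁻¹` holomorphic, Farkas–Kra I.1.5). [cite: FarkasKra1992, IV.6.1 Theorem (a), I.1.5] -/
theorem exists_homeomorph_of_arithGenus_eq_zero (h0 : arithGenus N = 0) :
    ∃ e : Y ≃ₜ N, ⇑e = q ∧ MDifferentiable 𝓘(ℂ, ℂ) 𝓘(ℂ, ℂ) e.symm :=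
  exists_homeomorph_mdifferentiable_symm hq (bijective_of_arithGenus_eq_zero hc h0)

include hq hc in
/-- `g(N) = 0 ⇒ g(Y) = 0` for an unramified holomorphic covering `Y → N` of compact connected Riemann surfaces (one
sheet: Riemann–Hurwitz `g(Y) − 1 = 1 · (0 − 1)`). [cite: FarkasKra1992, I.2.7, IV.6.3] -/
theorem arithGenus_eq_zero_of_arithGenus_eq_zero (h0 : arithGenus N = 0) : arithGenus Y = 0 := by
  have hne : ∃ a b, q a ≠ q b := hc.exists_apply_ne_of_compactSpace
  obtain ⟨x₀⟩ : Nonempty N := inferInstance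
  have h := hc.arithGenus_sub_one_eq hq hne x₀
  rw [ncard_preimage_eq_one_of_arithGenus_eq_zero hc h0 x₀, h0] at h
  push_cast at h
  omega

include hc in
/-- `g(N) = 0 ⇒ 𝒦(Y) = q^*𝒦(N)`: the function field extension of an unramified covering of the sphere is trivial
(`[𝒦(Y) : K] = [π₁ : q_*π₁] = 1`). [cite: Forster1981, §8.3 Theorem] [cite: FarkasKra1992, IV.6.1 Theorem (a)] -/
theorem finrank_eq_one_of_arithGenus_eq_zero (h0 : arithGenus N = 0) :
    finrank ↥(comap q hq hne).fieldRange (FunctionField Y) = 1 := by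
  obtain ⟨e₀⟩ : Nonempty Y := inferInstance
  rw [finrank_fieldRange_comap_eq_index hq hne hc (⟨e₀, rfl⟩ : q ⁻¹' {q e₀}),
    ← ncard_preimage_eq_index_range_mapOfEq hc _ (q e₀), ncard_preimage_eq_one_of_arithGenus_eq_zero hc h0]

/-! ### §2 Genus `1`: every unramified covering is an abelian Galois covering by a torus -/

include hc in
omit [ChartedSpace ℂ Y] [ConnectedSpace Y] [IsManifold 𝓘(ℂ, ℂ) ω Y] [CompactSpace Y] [T2Space Y] in
/-- **Every unramified covering of a compact Riemann surface of genus `1` is normal (Galois)**: `π₁(N)` is abelian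
(IV.6.1 (b): `π₁ ≅ ℤ ⊕ ℤ`), so every subgroup, in particular `q_* π₁(Y, e₀)`, is normal.
[cite: FarkasKra1992, IV.6.1 Theorem (b)] [cite: HatcherAT2002, §1.3 Prop. 1.39 (p. 71), Example 1.13] -/
theorem normal_range_mapOfEq_of_arithGenus_eq_one (h1 : arithGenus N = 1) {x₀ : N}
    (e₀ : q ⁻¹' {x₀}) : (FundamentalGroup.mapOfEq ⟨q, hc.continuous⟩ e₀.2).range.Normal :=
  ⟨fun h hh g ↦ by rwa [mul_comm_of_arithGenus_eq_one h1 x₀ g h, mul_inv_cancel_right]⟩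

include hq hc in
/-- `g(N) = 1 ⇒ g(Y) = 1` for an unramified holomorphic covering (Riemann–Hurwitz with `B = 0`).
[cite: FarkasKra1992, I.2.7, V.1.10] -/
theorem arithGenus_eq_one_of_arithGenus_eq_one (h1 : arithGenus N = 1) : arithGenus Y = 1 :=
  (hc.arithGenus_eq_one_iff hq hc.exists_apply_ne_of_compactSpace).2 h1

include hc in
/-- **The function field extension of an unramified covering of a torus is abelian Galois**: for `g(N) = 1`,
`𝒦(Y)/q^*𝒦(N)` is Galois with commutative Galois group (`[π₁, π₁] = 1 ≤ q_* π₁(Y)`).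
[cite: Forster1981, §8.12 Theorem] [cite: FarkasKra1992, IV.6.1 Theorem (b)] -/
theorem isGalois_and_comm_of_arithGenus_eq_one (h1 : arithGenus N = 1) :
    IsGalois ↥(comap q hq hne).fieldRange (FunctionField Y) ∧
      ∀ σ τ : (FunctionField Y ≃ₐ[↥(comap q hq hne).fieldRange] FunctionField Y), σ * τ = τ * σ := by
  obtain ⟨e₀⟩ : Nonempty Y := inferInstance
  refine (isGalois_and_comm_iff_commutator_le hq hne hc (⟨e₀, rfl⟩ : q ⁻¹' {q e₀})).2 ?_
  rw [commutator_eq_bot_of_arithGenus_le_one h1.le (q e₀)]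
  exact bot_le

include hc in
/-- For `g(N) = 1`: `|Gal(𝒦(Y)/q^*𝒦(N))| = [π₁(N) : q_* π₁(Y)] =` the number of sheets `= [𝒦(Y) : q^*𝒦(N)]`.
[cite: Forster1981, §8.12 Theorem, §8.3] [cite: FarkasKra1992, IV.6.1 Theorem (b)] -/
theorem natCard_algEquiv_eq_ncard_of_arithGenus_eq_one (h1 : arithGenus N = 1) (y : N) :
    Nat.card (FunctionField Y ≃ₐ[↥(comap q hq hne).fieldRange] FunctionField Y) = (q ⁻¹' {y}).ncard ∧
      finrank ↥(comap q hq hne).fieldRange (FunctionField Y) = (q ⁻¹' {y}).ncard := by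
  obtain ⟨e₀⟩ : Nonempty Y := inferInstance
  have hN := normal_range_mapOfEq_of_arithGenus_eq_one hc h1 (⟨e₀, rfl⟩ : q ⁻¹' {q e₀})
  refine ⟨?_, ?_⟩
  · rw [(isGalois_and_natCard_algEquiv_eq_index_of_normal hq hne hc _ hN).2,
      ncard_preimage_eq_index_range_mapOfEq hc _ y]
  · rw [finrank_fieldRange_comap_eq_index hq hne hc (⟨e₀, rfl⟩ : q ⁻¹' {q e₀}),
      ncard_preimage_eq_index_range_mapOfEq hc _ y]

include hc in
/-- **The Galois group of an unramified covering of a torus is abelian on two generators**: for `g(N) = 1` there is a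
surjection `ℤ² ↠ Gal(𝒦(Y)/q^*𝒦(N))` (additively written). [cite: FarkasKra1992, IV.6.1 Theorem (b)]
[cite: Forster1981, §8.12 Theorem] [cite: HatcherAT2002, Example 1.13 (p. 34), §1.3 Prop. 1.39] -/
theorem exists_surjective_pi_int_two_gal_of_arithGenus_eq_one (h1 : arithGenus N = 1) :
    ∃ ψ : (Fin 2 → ℤ) →+ Additive (FunctionField Y ≃ₐ[↥(comap q hq hne).fieldRange] FunctionField Y),
      Surjective ψ := by
  obtain ⟨e₀⟩ : Nonempty Y := inferInstance
  obtain ⟨hG, hcomm⟩ := isGalois_and_comm_of_arithGenus_eq_one hq hne hc h1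
  obtain ⟨ψ, hψ⟩ := exists_surjective_pi_int_gal_of_comm hq hne hc (⟨e₀, rfl⟩ : q ⁻¹' {q e₀}) hG hcomm
  -- reindex `ℤ^{2g} = ℤ²`
  let ε : (Fin 2 → ℤ) ≃ₗ[ℤ] (Fin (2 * arithGenus N) → ℤ) :=
    LinearEquiv.funCongrLeft ℤ ℤ (finCongr (by rw [h1]) : Fin (2 * arithGenus N) ≃ Fin 2)
  exact ⟨ψ.comp ε.toAddEquiv.toAddMonoidHom, hψ.comp ε.toAddEquiv.surjective⟩

omit hq hne hc

/-- **Every finite abelian group on two generators is the Galois group of an unramified covering of a torus by a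
torus**: for `g(N) = 1` and a surjection `ℤ² ↠ A` onto a finite abelian group there are a compact connected Riemann
surface `T` OF GENUS `1` and an unramified holomorphic covering `p : T → N` with `𝒦(T)/p^*𝒦(N)` Galois of degree `|A|`
and group `≅ Multiplicative A`. [cite: FarkasKra1992, IV.6.1 Theorem (b), V.1.10] [cite: Forster1981, §8.12 Theorem]
[cite: HatcherAT2002, §1.3 Exercise 19 (p. 82)] -/
theorem exists_genus_one_cover_of_addMonoidHom_surjective (h1 : arithGenus N = 1) (x₀ : N) {A : Type*}
    [AddCommGroup A] [Finite A] (ψ : (Fin 2 → ℤ) →+ A) (hψ : Surjective ψ) :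
    ∃ (T : Type u) (_ : TopologicalSpace T) (_ : ChartedSpace ℂ T) (_ : IsManifold 𝓘(ℂ, ℂ) ω T)
      (_ : CompactSpace T) (_ : T2Space T) (_ : ConnectedSpace T) (p : T → N)
      (hp : MDifferentiable 𝓘(ℂ, ℂ) 𝓘(ℂ, ℂ) p) (hpne : ∃ a b, p a ≠ p b),
      arithGenus T = 1 ∧ IsCoveringMap p ∧ IsGalois ↥(comap p hp hpne).fieldRange (FunctionField T) ∧
        finrank ↥(comap p hp hpne).fieldRange (FunctionField T) = Nat.card A ∧
        Nonempty ((FunctionField T ≃ₐ[↥(comap p hp hpne).fieldRange] FunctionField T) ≃* Multiplicative A) := by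
  let ε : (Fin (2 * arithGenus N) → ℤ) ≃ₗ[ℤ] (Fin 2 → ℤ) :=
    LinearEquiv.funCongrLeft ℤ ℤ (finCongr (by rw [h1]) : Fin 2 ≃ Fin (2 * arithGenus N))
  obtain ⟨T, i1, i2, i3, i4, i5, i6, p, hp, hpne, hpc, hG, hdeg, hiso⟩ :=
    exists_isGalois_mulEquiv_of_addMonoidHom_surjective x₀ (ψ.comp ε.toAddEquiv.toAddMonoidHom)
      (hψ.comp ε.toAddEquiv.surjective)
  exact ⟨T, i1, i2, i3, i4, i5, i6, p, hp, hpne, (hpc.arithGenus_eq_one_iff hp hpne).2 h1, hpc, hG, hdeg, hiso⟩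

end RiemannSurface

end Literature.Geometry.Kaehler

end
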